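import Mathlib

/-!
# Frame-capacity toolkit A: basic containments, (S1) and (Mono)

Support file for crux item `stmt-MatrixMultiplication-10752`
(`Summit.MatrixMultiplication.MatrixMultiplication.Theses.HiddenToeplitzCorners.HiddenCornerLemmaR`),
line `frobenius-dual-short-syzygies`, stub `stub_gconstDualLaw` / the strip theorem
(paper proof `math/STRIP_THEOREM.md` §1, items (R1), (S1), (Mono)).

Setting (elementary linear algebra over `ℂ[X]`, no matrices).  A frame is `e : Fin r → ℂ[X]`;
the down-shift is `δ := Polynomial.divX`; a coefficient polynomial `α` acts on `f` by
`act α f := Σ_i (coeff α i) • δ^[i] f`, written through `Polynomial.lsum` as the linear map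
`lsum (fun i => smulRight id (δ^[i] f)) : ℂ[X] →ₗ[ℂ] ℂ[X]`; the evaluation map of the frame is
`Ev α := Σ_c act (α c) (e c)` (a sum of `comp`s with the projections); the relations of
coefficient-degree `< w` are `Rel_w := ker Ev ⊓ pi univ (fun _ => degreeLT ℂ w)`; `S_w` is the span
of all components of all such relations, `⨆ b, map (proj b) Rel_w`.  No definitions are introduced:
every statement is written out in these terms (the expanded form of the lead's local notation
`actL`, `EvL`, `DegLT`, `RelL`, `SL`, `mulXL`).

Results:
* `hclR_act_X_mul`: `act (X * α) f = δ (act α f)` (the coefficients of `X * α` are shifted);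
* `hclR_SL_le_degreeLT`: `S_w ≤ degreeLT w`;
* `hclR_RelL_mono`: `Rel_w ≤ Rel_{w+1}`;
* `hclR_RelL_X_mul`: `X • Rel_w ≤ Rel_{w+1}` (componentwise);
* `hclR_SL_sup_X_mul_le` (S1): `S_w ⊔ X • S_w ≤ S_{w+1}`;
* `hclR_SL_full_succ` (Mono): for `1 ≤ w`, `S_w = degreeLT w ⟹ S_{w+1} = degreeLT (w+1)`
  (every `p` of degree `< w+1` is `X * δ p + C (coeff p 0)` with `δ p ∈ degreeLT w`; the
  hypothesis `1 ≤ w` is needed: for `w = 0` the premise is vacuous while `S_1 = ⊥` whenever `e` is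
  linearly independent).
Helpers: `hclR_capA_act_monomial`, `hclR_capA_X_mul_mem_degreeLT`, `hclR_capA_divX_mem_degreeLT`,
`hclR_capA_EvL_apply`.  Folklore.
-/

set_option linter.dupNamespace false

namespace Summit.MatrixMultiplication.MatrixMultiplication.Theorems

open Polynomial

/-! ## Helpers -/

/-- The action of a monomial coefficient polynomial: `act (a X^n) f = a • δ^[n] f`. -/
theorem hclR_capA_act_monomial (f : ℂ[X]) (n : ℕ) (a : ℂ) :
    (Polynomial.lsum (fun (i : ℕ) => LinearMap.smulRight (LinearMap.id : ℂ →ₗ[ℂ] ℂ)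
      (Polynomial.divX^[i] f)) : ℂ[X] →ₗ[ℂ] ℂ[X]) (Polynomial.monomial n a) =
      a • Polynomial.divX^[n] f := by
  rw [Polynomial.lsum_apply, Polynomial.sum_monomial_index]
  · rfl
  · simp

/-- Multiplication by `X` raises the degree bound by one:
`p ∈ degreeLT w ⟹ X * p ∈ degreeLT (w+1)`. -/
theorem hclR_capA_X_mul_mem_degreeLT {w : ℕ} {p : ℂ[X]} (hp : p ∈ Polynomial.degreeLT ℂ w) :
    X * p ∈ Polynomial.degreeLT ℂ (w + 1) := by
  rw [Polynomial.mem_degreeLT] at hp ⊢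
  rw [(Polynomial.commute_X p).eq, Polynomial.degree_mul_X, Nat.cast_succ]
  exact WithBot.add_lt_add_right WithBot.one_ne_bot hp

/-- The down-shift lowers the degree bound by one: `p ∈ degreeLT (w+1) ⟹ δ p ∈ degreeLT w`. -/
theorem hclR_capA_divX_mem_degreeLT {w : ℕ} {p : ℂ[X]} (hp : p ∈ Polynomial.degreeLT ℂ (w + 1)) :
    Polynomial.divX p ∈ Polynomial.degreeLT ℂ w := by
  rw [Polynomial.mem_degreeLT, Polynomial.degree_lt_iff_coeff_zero] at hp ⊢
  intro m hm
  rw [Polynomial.coeff_divX]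
  exact hp (m + 1) (Nat.succ_le_succ hm)

variable {r : ℕ} (e : Fin r → ℂ[X]) in
/-- The evaluation map on a tuple: `Ev α = Σ_c act (α c) (e c)`. -/
theorem hclR_capA_EvL_apply (α : Fin r → ℂ[X]) :
    (∑ c : Fin r, LinearMap.comp (Polynomial.lsum (fun (i : ℕ) => LinearMap.smulRight
      (LinearMap.id : ℂ →ₗ[ℂ] ℂ) (Polynomial.divX^[i] (e c))) : ℂ[X] →ₗ[ℂ] ℂ[X])
      (LinearMap.proj c : (Fin r → ℂ[X]) →ₗ[ℂ] ℂ[X])) α =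
      ∑ c : Fin r, (Polynomial.lsum (fun (i : ℕ) => LinearMap.smulRight (LinearMap.id : ℂ →ₗ[ℂ] ℂ)
        (Polynomial.divX^[i] (e c))) : ℂ[X] →ₗ[ℂ] ℂ[X]) (α c) := by
  rw [LinearMap.sum_apply]
  rfl

/-! ## The registered toolkit statements -/

set_option linter.unusedVariables false in
/-- `act (X * α) f = δ (act α f)`: the coefficients of `X * α` are those of `α` shifted up by one,
so `Σ_i coeff (Xα) i • δ^[i] f = Σ_j coeff α j • δ^[j+1] f = δ (act α f)` by additivity and
`ℂ`-linearity of `δ`.  (The frame argument `e` is unused; it is part of the registered form, whose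
named binders are why the unused-variables linter is switched off on three statements.) -/
theorem hclR_act_X_mul :
    ∀ {r : ℕ} (e : Fin r → Polynomial ℂ) (f α : (Polynomial ℂ)), ((Polynomial.lsum (fun (i : ℕ) =>
    LinearMap.smulRight (LinearMap.id : ℂ →ₗ[ℂ] ℂ) (Polynomial.divX^[i] (f : Polynomial ℂ))) :
    Polynomial ℂ →ₗ[ℂ] Polynomial ℂ)) (Polynomial.X * α) = Polynomial.divX (((Polynomial.lsum (fun
    (i : ℕ) => LinearMap.smulRight (LinearMap.id : ℂ →ₗ[ℂ] ℂ) (Polynomial.divX^[i] (f : Polynomial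
    ℂ))) : Polynomial ℂ →ₗ[ℂ] Polynomial ℂ)) α) := by
  intro _ _ f α
  induction α using Polynomial.induction_on' with
  | add p q hp hq => rw [mul_add, map_add, map_add, hp, hq, Polynomial.divX_add]
  | monomial n a =>
    rw [Polynomial.X_mul_monomial, hclR_capA_act_monomial, hclR_capA_act_monomial,
      Function.iterate_succ_apply', Polynomial.smul_eq_C_mul, Polynomial.smul_eq_C_mul,
      Polynomial.divX_C_mul]

/-- Components of relations of coefficient-degree `< w` have degree `< w`: `S_w ≤ degreeLT w`. -/
theorem hclR_SL_le_degreeLT :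
    ∀ {r : ℕ} (e : Fin r → Polynomial ℂ) (w : ℕ), (⨆ b : Fin r, Submodule.map (LinearMap.proj b :
    (Fin r → Polynomial ℂ) →ₗ[ℂ] Polynomial ℂ) (LinearMap.ker (∑ c : Fin r, LinearMap.comp
    (Polynomial.lsum (fun (i : ℕ) => LinearMap.smulRight (LinearMap.id : ℂ →ₗ[ℂ] ℂ)
    (Polynomial.divX^[i] (e c : Polynomial ℂ))) : Polynomial ℂ →ₗ[ℂ] Polynomial ℂ) (LinearMap.proj
    c : (Fin r → Polynomial ℂ) →ₗ[ℂ] Polynomial ℂ)) ⊓ (Submodule.pi Set.univ (fun _ : Fin r =>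
    Polynomial.degreeLT ℂ (w)) : Submodule ℂ (Fin r → Polynomial ℂ)))) ≤ Polynomial.degreeLT ℂ w
    := by
  intro _ _ w
  refine iSup_le fun b => ?_
  rintro _ ⟨α, hα, rfl⟩
  exact hα.2 b (Set.mem_univ b)

/-- (R1, first half) `Rel_w ≤ Rel_{w+1}`, since `degreeLT w ≤ degreeLT (w+1)`. -/
theorem hclR_RelL_mono :
    ∀ {r : ℕ} (e : Fin r → Polynomial ℂ) (w : ℕ), (LinearMap.ker (∑ c : Fin r, LinearMap.comp
    (Polynomial.lsum (fun (i : ℕ) => LinearMap.smulRight (LinearMap.id : ℂ →ₗ[ℂ] ℂ)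
    (Polynomial.divX^[i] (e c : Polynomial ℂ))) : Polynomial ℂ →ₗ[ℂ] Polynomial ℂ) (LinearMap.proj
    c : (Fin r → Polynomial ℂ) →ₗ[ℂ] Polynomial ℂ)) ⊓ (Submodule.pi Set.univ (fun _ : Fin r =>
    Polynomial.degreeLT ℂ (w)) : Submodule ℂ (Fin r → Polynomial ℂ))) ≤ (LinearMap.ker (∑ c : Fin
    r, LinearMap.comp (Polynomial.lsum (fun (i : ℕ) => LinearMap.smulRight (LinearMap.id : ℂ →ₗ[ℂ]
    ℂ) (Polynomial.divX^[i] (e c : Polynomial ℂ))) : Polynomial ℂ →ₗ[ℂ] Polynomial ℂ)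
    (LinearMap.proj c : (Fin r → Polynomial ℂ) →ₗ[ℂ] Polynomial ℂ)) ⊓ (Submodule.pi Set.univ (fun
    _ : Fin r => Polynomial.degreeLT ℂ (w + 1)) : Submodule ℂ (Fin r → Polynomial ℂ))) := by
  intro _ _ w
  exact inf_le_inf_left _ (Submodule.pi_mono fun _ _ => Polynomial.degreeLT_mono (Nat.le_succ w))

set_option linter.unusedVariables false in
/-- (R1, second half) `X • Rel_w ≤ Rel_{w+1}`: if `α` is a relation of coefficient-degree `< w` then
`(X * α c)_c` has coefficient-degree `< w + 1` and
`Σ_c act (X α_c) e_c = δ (Σ_c act α_c e_c) = 0`. -/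
theorem hclR_RelL_X_mul :
    ∀ {r : ℕ} (e : Fin r → Polynomial ℂ) (w : ℕ) (α : Fin r → (Polynomial ℂ)) (hα : α ∈
    (LinearMap.ker (∑ c : Fin r, LinearMap.comp (Polynomial.lsum (fun (i : ℕ) =>
    LinearMap.smulRight (LinearMap.id : ℂ →ₗ[ℂ] ℂ) (Polynomial.divX^[i] (e c : Polynomial ℂ))) :
    Polynomial ℂ →ₗ[ℂ] Polynomial ℂ) (LinearMap.proj c : (Fin r → Polynomial ℂ) →ₗ[ℂ] Polynomial
    ℂ)) ⊓ (Submodule.pi Set.univ (fun _ : Fin r => Polynomial.degreeLT ℂ (w)) : Submodule ℂ (Fin r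
    → Polynomial ℂ)))), (fun c => Polynomial.X * α c) ∈ (LinearMap.ker (∑ c : Fin r,
    LinearMap.comp (Polynomial.lsum (fun (i : ℕ) => LinearMap.smulRight (LinearMap.id : ℂ →ₗ[ℂ] ℂ)
    (Polynomial.divX^[i] (e c : Polynomial ℂ))) : Polynomial ℂ →ₗ[ℂ] Polynomial ℂ) (LinearMap.proj
    c : (Fin r → Polynomial ℂ) →ₗ[ℂ] Polynomial ℂ)) ⊓ (Submodule.pi Set.univ (fun _ : Fin r =>
    Polynomial.degreeLT ℂ (w + 1)) : Submodule ℂ (Fin r → Polynomial ℂ))) := by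
  intro _ e w α hα
  obtain ⟨hker, hdeg⟩ := Submodule.mem_inf.1 hα
  rw [LinearMap.mem_ker, hclR_capA_EvL_apply] at hker
  refine Submodule.mem_inf.2 ⟨?_, fun c _ => hclR_capA_X_mul_mem_degreeLT (hdeg c (Set.mem_univ c))⟩
  rw [LinearMap.mem_ker, hclR_capA_EvL_apply]
  simp only [hclR_act_X_mul e]
  rw [← Polynomial.divX_zero, ← hker]
  simp only [← Polynomial.divX_hom_toFun]
  exact (map_sum Polynomial.divX_hom _ _).symm

/-- (S1) `S_w ⊔ X • S_w ≤ S_{w+1}`: `S_w ≤ S_{w+1}` from `Rel_w ≤ Rel_{w+1}`, and `X` times the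
`b`-component of a relation `α ∈ Rel_w` is the `b`-component of `(X α_c)_c ∈ Rel_{w+1}`. -/
theorem hclR_SL_sup_X_mul_le :
    ∀ {r : ℕ} (e : Fin r → Polynomial ℂ) (w : ℕ), (⨆ b : Fin r, Submodule.map (LinearMap.proj b :
    (Fin r → Polynomial ℂ) →ₗ[ℂ] Polynomial ℂ) (LinearMap.ker (∑ c : Fin r, LinearMap.comp
    (Polynomial.lsum (fun (i : ℕ) => LinearMap.smulRight (LinearMap.id : ℂ →ₗ[ℂ] ℂ)
    (Polynomial.divX^[i] (e c : Polynomial ℂ))) : Polynomial ℂ →ₗ[ℂ] Polynomial ℂ) (LinearMap.proj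
    c : (Fin r → Polynomial ℂ) →ₗ[ℂ] Polynomial ℂ)) ⊓ (Submodule.pi Set.univ (fun _ : Fin r =>
    Polynomial.degreeLT ℂ (w)) : Submodule ℂ (Fin r → Polynomial ℂ)))) ⊔ Submodule.map
    (LinearMap.mulLeft ℂ (Polynomial.X : Polynomial ℂ) : Polynomial ℂ →ₗ[ℂ] Polynomial ℂ) ((⨆ b :
    Fin r, Submodule.map (LinearMap.proj b : (Fin r → Polynomial ℂ) →ₗ[ℂ] Polynomial ℂ)
    (LinearMap.ker (∑ c : Fin r, LinearMap.comp (Polynomial.lsum (fun (i : ℕ) =>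
    LinearMap.smulRight (LinearMap.id : ℂ →ₗ[ℂ] ℂ) (Polynomial.divX^[i] (e c : Polynomial ℂ))) :
    Polynomial ℂ →ₗ[ℂ] Polynomial ℂ) (LinearMap.proj c : (Fin r → Polynomial ℂ) →ₗ[ℂ] Polynomial
    ℂ)) ⊓ (Submodule.pi Set.univ (fun _ : Fin r => Polynomial.degreeLT ℂ (w)) : Submodule ℂ (Fin r
    → Polynomial ℂ))))) ≤ (⨆ b : Fin r, Submodule.map (LinearMap.proj b : (Fin r → Polynomial ℂ)
    →ₗ[ℂ] Polynomial ℂ) (LinearMap.ker (∑ c : Fin r, LinearMap.comp (Polynomial.lsum (fun (i : ℕ)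
    => LinearMap.smulRight (LinearMap.id : ℂ →ₗ[ℂ] ℂ) (Polynomial.divX^[i] (e c : Polynomial ℂ)))
    : Polynomial ℂ →ₗ[ℂ] Polynomial ℂ) (LinearMap.proj c : (Fin r → Polynomial ℂ) →ₗ[ℂ] Polynomial
    ℂ)) ⊓ (Submodule.pi Set.univ (fun _ : Fin r => Polynomial.degreeLT ℂ (w + 1)) : Submodule ℂ
    (Fin r → Polynomial ℂ)))) := by
  intro _ e w
  refine sup_le (iSup_mono fun b => Submodule.map_mono (hclR_RelL_mono e w)) ?_
  rw [Submodule.map_iSup]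
  refine iSup_le fun b => ?_
  rintro _ ⟨_, ⟨α, hα, rfl⟩, rfl⟩
  exact Submodule.mem_iSup_of_mem b ⟨fun c => X * α c, hclR_RelL_X_mul e w α hα, rfl⟩

set_option linter.unusedVariables false in
/-- (Mono) for `1 ≤ w`: if `S_w = degreeLT w` then `S_{w+1} = degreeLT (w+1)`.  Indeed
`S_{w+1} ≤ degreeLT (w+1)` always, and conversely every `p` of degree `< w+1` equals
`X * δ p + C (coeff p 0)` with `δ p ∈ degreeLT w = S_w` and `C _ ∈ degreeLT 1 ≤ degreeLT w = S_w`
(this is where `1 ≤ w` is used), so `p ∈ X • S_w ⊔ S_w ≤ S_{w+1}` by (S1). -/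
theorem hclR_SL_full_succ :
    ∀ {r : ℕ} (e : Fin r → Polynomial ℂ) (w : ℕ) (hw : 1 ≤ w) (h : (⨆ b : Fin r, Submodule.map
    (LinearMap.proj b : (Fin r → Polynomial ℂ) →ₗ[ℂ] Polynomial ℂ) (LinearMap.ker (∑ c : Fin r,
    LinearMap.comp (Polynomial.lsum (fun (i : ℕ) => LinearMap.smulRight (LinearMap.id : ℂ →ₗ[ℂ] ℂ)
    (Polynomial.divX^[i] (e c : Polynomial ℂ))) : Polynomial ℂ →ₗ[ℂ] Polynomial ℂ) (LinearMap.proj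
    c : (Fin r → Polynomial ℂ) →ₗ[ℂ] Polynomial ℂ)) ⊓ (Submodule.pi Set.univ (fun _ : Fin r =>
    Polynomial.degreeLT ℂ (w)) : Submodule ℂ (Fin r → Polynomial ℂ)))) = Polynomial.degreeLT ℂ w),
    (⨆ b : Fin r, Submodule.map (LinearMap.proj b : (Fin r → Polynomial ℂ) →ₗ[ℂ] Polynomial ℂ)
    (LinearMap.ker (∑ c : Fin r, LinearMap.comp (Polynomial.lsum (fun (i : ℕ) =>
    LinearMap.smulRight (LinearMap.id : ℂ →ₗ[ℂ] ℂ) (Polynomial.divX^[i] (e c : Polynomial ℂ))) :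
    Polynomial ℂ →ₗ[ℂ] Polynomial ℂ) (LinearMap.proj c : (Fin r → Polynomial ℂ) →ₗ[ℂ] Polynomial
    ℂ)) ⊓ (Submodule.pi Set.univ (fun _ : Fin r => Polynomial.degreeLT ℂ (w + 1)) : Submodule ℂ
    (Fin r → Polynomial ℂ)))) = Polynomial.degreeLT ℂ (w + 1) := by
  intro _ e w hw h
  refine le_antisymm (hclR_SL_le_degreeLT e (w + 1)) fun p hp => ?_
  have h5 := hclR_SL_sup_X_mul_le e w
  rw [h] at h5
  have hX : (LinearMap.mulLeft ℂ (Polynomial.X : ℂ[X])) (Polynomial.divX p) ∈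
      Submodule.map (LinearMap.mulLeft ℂ (Polynomial.X : ℂ[X]) : ℂ[X] →ₗ[ℂ] ℂ[X])
        (Polynomial.degreeLT ℂ w) :=
    Submodule.mem_map_of_mem (hclR_capA_divX_mem_degreeLT hp)
  have hC : Polynomial.C (p.coeff 0) ∈ Polynomial.degreeLT ℂ w :=
    Polynomial.degreeLT_mono hw
      (Polynomial.mem_degreeLT.2 (Polynomial.degree_C_le.trans_lt (by exact_mod_cast zero_lt_one)))
  rw [← Polynomial.X_mul_divX_add p]
  exact h5 (Submodule.add_mem _ (Submodule.mem_sup_right hX) (Submodule.mem_sup_left hC))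

end Summit.MatrixMultiplication.MatrixMultiplication.Theorems
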